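import Literature.Computability.Complexity.StackStrings
import Literature.Computability.Complexity.StackModArith
import Mathlib.Logic.Embedding.Basic
import HarnessLib

/-!
# Lists of numerals on stack programs: emission, ordered insertion, insertion sort

Trunk `CplxCore`, toolkit continuing `StackStrings.lean` (pair decoder `unpairW`, flags) and
`StackArith.lean` (comparison by conditional subtraction `sub`). A list of bit strings
`[a₁, …, a_k]` is held in a register as the nested pair
`encList [a₁, …, a_k] = boolPair a₁ (boolPair a₂ (… (boolPair a_k []) …))`, i.e. the
concatenation of the doubled elements each followed by the separator `01`
(`encList_eq_flatMap`); the empty list is the empty string, which is not a well-formed pair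
(`wellPaired_encList`), so a list is read off by repeated `unpairW` until the flag drops.

* `Com.emit h o` — append the element in `h` to the list whose *reversal* is in `o`
  (`runs_emit`; `outRev`, `outRev_append`);
* `Com.insertSorted r` — **ordered insertion** of the bank numeral `y` into the sorted coded
  list in `lst`, the result appended (reversed) to `outR`; the ten work registers are named by
  an embedding `r : LIx ↪ κ` into the user's register type. One clocked step `Com.insStep`
  with the abstract model `insAbs` on `InsState` (`runs_insStep`), the clocked loop
  (`runs_insLoop`, `insAbs_iterate`) and the wrapper (`runs_insertSorted`: the emitted list is
  `insModel v l = l.orderedInsert (· ≤ ·  on values) v`);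
* `Com.isort r` — **insertion sort**: the elements of `src` inserted in order into `lst`
  (`runs_isortStep`, `runs_isortLoop`, `runs_isort`; model `isortModel acc l`, a permutation of
  `acc ++ l`, `perm_isortModel`), polynomial step bound `isortStepCost`.

Served: the sorted output list of the classical part of Shor's algorithm
(`ShorFactoring.lean`: `List.insertionSort` of the factors found; programming fact
`shorComp_isPolyTime` of `ShorClassicalOracle.lean`) and work lists of numerals in general.

## References

* T. H. Cormen, C. E. Leiserson, R. L. Rivest, C. Stein, *Introduction to Algorithms*, MIT Press
  (3rd ed. 2009), §2.1 (INSERTION-SORT; here one pass of its inner loop as `insertSorted`).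
* S. Arora, B. Barak, *Computational Complexity: A Modern Approach*, CUP 2009, §0.1 (tuples of
  strings), §1.3 (robustness of polynomial time).
* T. Nipkow, G. Klein, *Concrete Semantics with Isabelle/HOL*, Springer 2014, Ch. 7, for the
  verification style.
-/

namespace Literature.Computability.Complexity

open _root_.Computability AReg

/-- The register coding of a list of bit strings: nested pairs. [cite: AroraBarak2009, §0.1 (tuples of strings)] -/
def encList : List (List Bool) → List Bool
  | [] => []
  | a :: l => boolPair a (encList l)

/-- The coding of the empty list. [folklore] -/
@[simp] theorem encList_nil : encList [] = [] := rfl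

/-- The coding of a nonempty list. [folklore] -/
theorem encList_cons (a : List Bool) (l : List (List Bool)) : encList (a :: l) = boolPair a (encList l) := rfl

/-- A nonempty coded list is a well-formed pair; the empty one is not. [folklore] -/
theorem wellPaired_encList (l : List (List Bool)) : wellPaired (encList l) = decide (l ≠ []) := by
  cases l with
  | nil => rfl
  | cons a l => rw [encList_cons, wellPaired_boolPair]; simp

/-- Decoding a nonempty coded list. [folklore] -/
theorem boolUnpair_encList_cons (a : List Bool) (l : List (List Bool)) :
    boolUnpair (encList (a :: l)) = (a, encList l) := by
  rw [encList_cons, boolUnpair_boolPair]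

/-- Length of a coded list. [folklore] -/
theorem length_encList (l : List (List Bool)) :
    (encList l).length = (l.map fun a => 2 * a.length + 2).sum := by
  induction l with
  | nil => rfl
  | cons a l ih => rw [encList_cons, length_boolPair, ih]; simp

/-- The doubled bits of an element, reversed, as pushed by `emit`. [folklore] -/
theorem reverse_flatMap_dbl (a : List Bool) :
    (a.flatMap fun b => [b, b]).reverse = a.reverse.flatMap fun b => [b, b] := by
  induction a with
  | nil => rfl
  | cons b a ih => simp [List.flatMap_cons, ih]

namespace Com

variable {ι : Type} [DecidableEq ι]

/-! ### Emitting an element onto a reversed output -/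

/-- `emit h o`: append the element held in `h` (consumed) to the list whose *reversal* is held
in `o`: push every bit of `h` twice, then the separator. [folklore] -/
def emit (h o : ι) : Com ι :=
  loop h (push o true ;; push o true) (push o false ;; push o false) ;; (push o false ;; push o true)

/-- **Simulation of `emit`**: the new content of `o` is `[true, false] ++ (dbl h)ʳ ++ o`, so
that `reverse o` grows by `dbl h ++ [false, true]` (one coded element, `outRev_append`); `h` is
emptied; cost `4|h| + 3`. [folklore] -/
theorem runs_emit {h o : ι} (hho : h ≠ o) (R : Regs ι) :
    Runs (emit h o) R
      (Function.update (Function.update R h []) o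
        (true :: false :: (((R h).flatMap fun b => [b, b]).reverse ++ R o)))
      (4 * (R h).length + 3) := by
  let f : Bool → Regs ι → Regs ι := fun b S => Function.update S o (b :: b :: S o)
  have hlp := runs_loop_of_fun (k := h) (ct := push o true ;; push o true) (cf := push o false ;; push o false) f 2
    (fun b w S hk => ⟨by
        cases b
        · exact (Runs.push o false _).seq (Runs.push' (by simp [f]))
        · exact (Runs.push o true _).seq (Runs.push' (by simp [f])),
      by simp [f, Function.update_of_ne hho]⟩) (R h) R rfl
  have hiter : ∀ (w : List Bool) (S : Regs ι), S h = w →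
      loopIter h f w S = Function.update (Function.update S h []) o ((w.flatMap fun b => [b, b]).reverse ++ S o) := by
    intro w
    induction w with
    | nil =>
      intro S hS
      have h0 : Function.update S h [] = S := Function.update_eq_self_iff.2 hS.symm
      rw [loopIter_nil, h0]
      simp
    | cons b w ih =>
      intro S hS
      rw [loopIter_cons, ih _ (by simp [f, Function.update_of_ne hho])]
      funext i
      by_cases hio : i = o
      · subst hio; simp [f, Function.update_of_ne hho.symm, List.flatMap_cons]
      · by_cases hih : i = h
        · subst hih; simp [f, Function.update_of_ne hio]
        · simp [f, Function.update_of_ne hio, Function.update_of_ne hih]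
  rw [hiter _ _ rfl] at hlp
  have hfin : Runs (push o false ;; push o true)
      (Function.update (Function.update R h []) o (((R h).flatMap fun b => [b, b]).reverse ++ R o))
      (Function.update (Function.update R h []) o (true :: false :: (((R h).flatMap fun b => [b, b]).reverse ++ R o)))
      2 := by
    refine ((Runs.push' rfl).seq (Runs.push' ?_)).of_eq rfl (by omega)
    simp
  exact (hlp.seq hfin).of_eq rfl (by omega)


/-- The coding of a list is the concatenation of its emitted elements. [folklore] -/
theorem encList_eq_flatMap (l : List (List Bool)) :
    encList l = l.flatMap fun a => (a.flatMap fun b => [b, b]) ++ [false, true] := by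
  induction l with
  | nil => rfl
  | cons a l ih => rw [encList_cons, List.flatMap_cons, ← ih]; simp [boolPair]

/-- After `emit`, the reversed output extends by one coded element: if `o = (pre)ʳ` then the
new content is `(pre ++ dbl a ++ [false, true])ʳ`. [folklore] -/
theorem emit_reverse (a pre : List Bool) :
    true :: false :: ((a.flatMap fun b => [b, b]).reverse ++ pre.reverse) =
      (pre ++ ((a.flatMap fun b => [b, b]) ++ [false, true])).reverse := by
  simp

/-! ### Ordered insertion of the bank numeral `y` into a coded sorted list -/

/-- Register roles of the list routines (realised in the user's register type by an
embedding). [folklore] -/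
inductive LIx where
  | lst | outR | F | H | INS | DN | A | T | M | P | src | F2
  deriving DecidableEq, Fintype

section Insert

variable {κ : Type} [DecidableEq κ] (r : LIx ↪ κ)

/-- One clocked step of the ordered insertion (see `insertSorted`). [folklore] -/
def insStep : Com (κ ⊕ AReg) :=
  ifFlag (Sum.inl (r .DN)) skip
    (unpairW (Sum.inl (r .lst)) (Sum.inl (r .A)) (Sum.inl (r .T)) (Sum.inl (r .M)) (Sum.inl (r .P)) ;;
      pop (Sum.inl (r .M))
        (pour (Sum.inl (r .T)) (Sum.inl (r .lst)) ;;
          (pour (Sum.inl (r .A)) (Sum.inr .x) ;;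
          (copy (Sum.inr .x) (Sum.inl (r .H)) (Sum.inr .s) (Sum.inr .t) ;;
          ifFlag (Sum.inl (r .INS))
            (bk (clear .x) ;; emit (Sum.inl (r .H)) (Sum.inl (r .outR)))
            (bk sub ;;
              pop (Sum.inr .g)
                (bk (clear .x) ;;
                  (copy (Sum.inr .y) (Sum.inl (r .A)) (Sum.inr .s) (Sum.inr .t) ;;
                  (emit (Sum.inl (r .A)) (Sum.inl (r .outR)) ;;
                  (emit (Sum.inl (r .H)) (Sum.inl (r .outR)) ;;
                  push (Sum.inl (r .INS)) true))))
                skip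
                (bk (clear .x) ;; emit (Sum.inl (r .H)) (Sum.inl (r .outR)))))))
        skip
        (push (Sum.inl (r .DN)) true ;;
          ifFlag (Sum.inl (r .INS)) skip
            (copy (Sum.inr .y) (Sum.inl (r .A)) (Sum.inr .s) (Sum.inr .t) ;;
              (emit (Sum.inl (r .A)) (Sum.inl (r .outR)) ;; push (Sum.inl (r .INS)) true))))

/-- `insertSorted r`: **ordered insertion** of the bank numeral `y` (preserved) into the
sorted coded list held in `lst` (consumed), the result being *appended, reversed,* to `outR`:
clock `|lst| + 1` steps into `F`, then run `insStep` per clock bit. [cite: CLRS2009, §2.1 (INSERTION-SORT, inner loop)] -/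
def insertSorted : Com (κ ⊕ AReg) :=
  copy (Sum.inl (r .lst)) (Sum.inl (r .F)) (Sum.inr .s) (Sum.inr .t) ;;
    (push (Sum.inl (r .F)) true ;; loop (Sum.inl (r .F)) (insStep r) (insStep r))

/-- Model of the insertion: insert `v` before the first element of value `≥ v` (Mathlib's
`List.orderedInsert` for the preorder by value). [folklore] -/
def insModel (v : List Bool) (l : List (List Bool)) : List (List Bool) :=
  l.orderedInsert (fun a b => bitsToNat a ≤ bitsToNat b) v

end Insert


section InsertSpec

variable {κ : Type} [DecidableEq κ] (r : LIx ↪ κ)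

/-- The coded form of an emitted prefix, reversed (the content of `outR`). [folklore] -/
def outRev (E : List (List Bool)) : List Bool :=
  (E.flatMap fun a => (a.flatMap fun b => [b, b]) ++ [false, true]).reverse

/-- `outRev` of the empty prefix. [folklore] -/
@[simp] theorem outRev_nil : outRev [] = [] := rfl

/-- Emitting one more element. [folklore] -/
theorem outRev_append (E : List (List Bool)) (a : List Bool) :
    outRev (E ++ [a]) = true :: false :: ((a.flatMap fun b => [b, b]).reverse ++ outRev E) := by
  simp [outRev]

/-- Emitting two more elements. [folklore] -/
theorem outRev_append_two (E : List (List Bool)) (a b : List Bool) :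
    outRev (E ++ [a, b]) =
      true :: false :: ((b.flatMap fun c => [c, c]).reverse ++
        (true :: false :: ((a.flatMap fun c => [c, c]).reverse ++ outRev E))) := by
  rw [show E ++ [a, b] = (E ++ [a]) ++ [b] by simp, outRev_append, outRev_append]

/-- The abstract state of the insertion: remaining elements, emitted prefix, the two latches.
[folklore] -/
structure InsState where
  /-- elements not yet read -/
  rem : List (List Bool)
  /-- elements emitted so far -/
  emitted : List (List Bool)
  /-- has `v` been emitted -/
  ins : Bool
  /-- has the list been exhausted -/
  dn : Bool

/-- One abstract step of the insertion of `v`. [folklore] -/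
def insAbs (v : List Bool) (st : InsState) : InsState :=
  if st.dn then st
  else match st.rem with
    | [] => ⟨[], if st.ins then st.emitted else st.emitted ++ [v], true, true⟩
    | h :: rem =>
      if st.ins then ⟨rem, st.emitted ++ [h], true, false⟩
      else if bitsToNat v ≤ bitsToNat h then ⟨rem, st.emitted ++ [v, h], true, false⟩
      else ⟨rem, st.emitted ++ [h], false, false⟩

/-- The register file of an abstract state over a base file `B` (output base `outR₀`). [folklore] -/
def ifile (B : Regs κ) (outR₀ : List Bool) (st : InsState) : Regs κ :=
  Function.update (Function.update (Function.update (Function.update B (r .lst) (encList st.rem))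
    (r .outR) (outRev st.emitted ++ outR₀)) (r .INS) (flag st.ins)) (r .DN) (flag st.dn)

/-- Cost of one clocked step with `n` bits of list and an element of `m` bits. [folklore] -/
def insCost (n m : ℕ) : ℕ := 45 * n + 30 * m + 50

end InsertSpec


section InsertRuns

variable {κ : Type} [DecidableEq κ] (r : LIx ↪ κ)

/-- Distinct roles sit in distinct registers. [folklore] -/
theorem LIx.ne_of {κ : Type} (r : LIx ↪ κ) {i j : LIx} (h : i ≠ j) : r i ≠ r j := r.injective.ne h

/-- Emitting the saved head: `x` cleared, `H` consumed onto `outR`. [folklore] -/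
theorem runs_emitH (T : Regs κ) (xh v zz : List Bool) :
    Runs (bk (clear .x) ;; emit (Sum.inl (r .H)) (Sum.inl (r .outR)) : Com (κ ⊕ AReg))
      (Sum.elim T (file xh v zz [] [] [] [] []))
      (Sum.elim (Function.update (Function.update T (r .H) []) (r .outR)
          (true :: false :: (((T (r .H)).flatMap fun b => [b, b]).reverse ++ T (r .outR))))
        (file [] v zz [] [] [] [] []))
      (2 * xh.length + 1 + (4 * (T (r .H)).length + 3)) := by
  have h1 : Runs (bk (clear .x) : Com (κ ⊕ AReg)) (Sum.elim T (file xh v zz [] [] [] [] []))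
      (Sum.elim T (file [] v zz [] [] [] [] [])) (2 * xh.length + 1) :=
    ((runs_clear AReg.x (file xh v zz [] [] [] [] [])).inr T).of_eq (by simp) (by simp)
  have h2 := runs_emit (h := (Sum.inl (r .H) : κ ⊕ AReg)) (o := Sum.inl (r .outR))
    (by simp [LIx.ne_of r]) (Sum.elim T (file [] v zz [] [] [] [] []))
  refine (h1.seq h2).of_eq ?_ (by simp)
  simp [-Sum.elim_update_left, -Sum.elim_update_right]

/-- Emitting `v` (copied from the bank) and then the saved head, latching `INS`. [folklore] -/
theorem runs_emitVH (T : Regs κ) (xj v zz : List Bool) (hA : T (r .A) = []) (hI : T (r .INS) = []) :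
    Runs (bk (clear .x) ;; (copy (Sum.inr .y) (Sum.inl (r .A)) (Sum.inr .s) (Sum.inr .t) ;;
        (emit (Sum.inl (r .A)) (Sum.inl (r .outR)) ;; (emit (Sum.inl (r .H)) (Sum.inl (r .outR)) ;;
        push (Sum.inl (r .INS)) true))) : Com (κ ⊕ AReg))
      (Sum.elim T (file xj v zz [] [] [] [] []))
      (Sum.elim (Function.update (Function.update (Function.update T (r .H) []) (r .outR)
          (true :: false :: (((T (r .H)).flatMap fun b => [b, b]).reverse ++
            (true :: false :: ((v.flatMap fun b => [b, b]).reverse ++ T (r .outR)))))) (r .INS) [true])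
        (file [] v zz [] [] [] [] []))
      (2 * xj.length + 1 + (10 * v.length + 3 + (4 * v.length + 3 + (4 * (T (r .H)).length + 3 + 1)))) := by
  have hne : ∀ {i j : LIx}, i ≠ j → r i ≠ r j := fun h => r.injective.ne h
  have h1 : Runs (bk (clear .x) : Com (κ ⊕ AReg)) (Sum.elim T (file xj v zz [] [] [] [] []))
      (Sum.elim T (file [] v zz [] [] [] [] [])) (2 * xj.length + 1) :=
    ((runs_clear AReg.x (file xj v zz [] [] [] [] [])).inr T).of_eq (by simp) (by simp)
  have h2 : Runs (copy (Sum.inr AReg.y) (Sum.inl (r .A)) (Sum.inr AReg.s) (Sum.inr AReg.t) : Com (κ ⊕ AReg))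
      (Sum.elim T (file [] v zz [] [] [] [] [])) (Sum.elim (Function.update T (r .A) v) (file [] v zz [] [] [] [] []))
      (10 * v.length + 3) :=
    (runs_copy (by simp) (by simp) (by simp) (by simp) (by simp) (by simp) _ (by simp) (by simp)).of_eq
      (by simp [-Sum.elim_update_left, -Sum.elim_update_right, hA]) (by simp)
  have h3 := runs_emit (h := (Sum.inl (r .A) : κ ⊕ AReg)) (o := Sum.inl (r .outR)) (by simp [hne])
    (Sum.elim (Function.update T (r .A) v) (file [] v zz [] [] [] [] []))
  simp only [Sum.elim_inl, Function.update_self, Sum.update_elim_inl, Function.update_idem] at h3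
  rw [Function.update_of_ne (hne (by decide))] at h3
  set T₃ := Function.update (Function.update T (r .A) []) (r .outR)
    (true :: false :: ((v.flatMap fun b => [b, b]).reverse ++ T (r .outR))) with hT₃
  have h4 := runs_emit (h := (Sum.inl (r .H) : κ ⊕ AReg)) (o := Sum.inl (r .outR)) (by simp [hne])
    (Sum.elim T₃ (file [] v zz [] [] [] [] []))
  simp only [Sum.elim_inl, Sum.update_elim_inl] at h4
  have hH : T₃ (r .H) = T (r .H) := by simp [hT₃, hne]
  have hO : T₃ (r .outR) = true :: false :: ((v.flatMap fun b => [b, b]).reverse ++ T (r .outR)) := by simp [hT₃]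
  rw [hH, hO] at h4
  set T₄ := Function.update (Function.update T₃ (r .H) []) (r .outR)
    (true :: false :: (((T (r .H)).flatMap fun b => [b, b]).reverse ++
      (true :: false :: ((v.flatMap fun b => [b, b]).reverse ++ T (r .outR))))) with hT₄
  have h5 : Runs (push (Sum.inl (r .INS)) true : Com (κ ⊕ AReg)) (Sum.elim T₄ (file [] v zz [] [] [] [] []))
      (Sum.elim (Function.update T₄ (r .INS) [true]) (file [] v zz [] [] [] [] [])) 1 :=
    Runs.push' (by simp [-Sum.elim_update_left, -Sum.elim_update_right, hT₄, hT₃, hne, hI])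
  refine (h1.seq (h2.seq (h3.seq (h4.seq h5)))).of_eq ?_ (by rfl)
  rw [hT₄, hT₃]
  congr 1
  have hA' : Function.update T (r .A) ([] : List Bool) = T := Function.update_eq_self_iff.2 hA.symm
  rw [hA']
  have hOH : r LIx.outR ≠ r LIx.H := hne (by decide)
  funext i
  by_cases h1 : i = r .INS
  · subst h1; simp
  · by_cases h2 : i = r .outR
    · subst h2; simp
    · by_cases h3 : i = r .H
      · subst h3; simp [hOH.symm]
      · simp [h1, h2, h3]

end InsertRuns


section InsertStep

variable {κ : Type} [DecidableEq κ] (r : LIx ↪ κ)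

/-- A register file is the insertion file `ifile …` if it reads accordingly. [folklore] -/
theorem eq_ifile (T B : Regs κ) (outR₀ : List Bool) (st : InsState)
    (hl : T (r .lst) = encList st.rem) (ho : T (r .outR) = outRev st.emitted ++ outR₀)
    (hi : T (r .INS) = flag st.ins) (hd : T (r .DN) = flag st.dn)
    (hrest : ∀ k, k ≠ r .lst → k ≠ r .outR → k ≠ r .INS → k ≠ r .DN → T k = B k) :
    T = ifile r B outR₀ st := by
  have hne : ∀ {i j : LIx}, i ≠ j → r i ≠ r j := fun h => r.injective.ne h
  funext k
  by_cases h1 : k = r .DN; · subst h1; simp [ifile, hd]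
  by_cases h2 : k = r .INS; · subst h2; simp [ifile, hi, hne]
  by_cases h3 : k = r .outR; · subst h3; simp [ifile, ho, hne]
  by_cases h4 : k = r .lst; · subst h4; simp [ifile, hl, hne]
  rw [hrest k h4 h3 h2 h1]
  simp [ifile, h1, h2, h3, h4]

/-- Reading the insertion file. [folklore] -/
theorem ifile_apply_of_ne (B : Regs κ) (outR₀ : List Bool) (st : InsState) {k : κ}
    (h1 : k ≠ r .lst) (h2 : k ≠ r .outR) (h3 : k ≠ r .INS) (h4 : k ≠ r .DN) :
    ifile r B outR₀ st k = B k := by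
  simp [ifile, h1, h2, h3, h4]

/-- **Simulation of one clocked insertion step** (see `insStep`, model `insAbs`): with the
step's own registers `A T M P H` empty in the base and the bank holding `x = 0`, `y = v`, one
step advances the abstract state, within `insCost n |v|` for `n ≥ |encList rem|`. [folklore] -/
theorem runs_insStep (B : Regs κ) (outR₀ v zz : List Bool) (st : InsState) (n : ℕ)
    (hA : B (r .A) = []) (hT : B (r .T) = []) (hM : B (r .M) = []) (hP : B (r .P) = [])
    (hH : B (r .H) = []) (hn : (encList st.rem).length ≤ n) :
    Runs (insStep r) (Sum.elim (ifile r B outR₀ st) (file [] v zz [] [] [] [] []))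
      (Sum.elim (ifile r B outR₀ (insAbs v st)) (file [] v zz [] [] [] [] [])) (insCost n v.length) := by
  have hne : ∀ {i j : LIx}, i ≠ j → r i ≠ r j := fun h => r.injective.ne h
  obtain ⟨rem, E, ins, dn⟩ := st
  set T0 := ifile r B outR₀ ⟨rem, E, ins, dn⟩ with hT0
  have r0 : ∀ {k : κ}, k ≠ r .lst → k ≠ r .outR → k ≠ r .INS → k ≠ r .DN → T0 k = B k :=
    fun h1 h2 h3 h4 => ifile_apply_of_ne r B outR₀ _ h1 h2 h3 h4
  have rA : T0 (r .A) = [] := (r0 (hne (by decide)) (hne (by decide)) (hne (by decide)) (hne (by decide))).trans hA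
  have rT : T0 (r .T) = [] := (r0 (hne (by decide)) (hne (by decide)) (hne (by decide)) (hne (by decide))).trans hT
  have rM : T0 (r .M) = [] := (r0 (hne (by decide)) (hne (by decide)) (hne (by decide)) (hne (by decide))).trans hM
  have rP : T0 (r .P) = [] := (r0 (hne (by decide)) (hne (by decide)) (hne (by decide)) (hne (by decide))).trans hP
  have rH : T0 (r .H) = [] := (r0 (hne (by decide)) (hne (by decide)) (hne (by decide)) (hne (by decide))).trans hH
  have rL : T0 (r .lst) = encList rem := by simp [hT0, ifile, hne]
  have rO : T0 (r .outR) = outRev E ++ outR₀ := by simp [hT0, ifile, hne]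
  have rI : T0 (r .INS) = flag ins := by simp [hT0, ifile, hne]
  have rD : T0 (r .DN) = flag dn := by simp [hT0, ifile]
  have hC : 3 ≤ insCost n v.length := by unfold insCost; omega
  cases dn
  · -- not done: read the list
    have hk0 : (Sum.elim T0 (file [] v zz [] [] [] [] []) : Regs (κ ⊕ AReg)) (Sum.inl (r .DN)) = flag false := by
      rw [Sum.elim_inl, rD]
    have hnd : [(Sum.inl (r .lst) : κ ⊕ AReg), Sum.inl (r .A), Sum.inl (r .T), Sum.inl (r .M), Sum.inl (r .P)].Nodup := by
      simp [hne]
    have h1 := runs_unpairW hnd (Sum.elim T0 (file [] v zz [] [] [] [] [])) (by rw [Sum.elim_inl, rM])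
      (by rw [Sum.elim_inl, rP])
    simp only [Sum.elim_inl, rL, rA, rT, List.append_nil, Sum.update_elim_inl] at h1
    cases rem with
    | nil =>
      -- the list is exhausted
      simp only [encList_nil, boolUnpair, List.reverse_nil, wellPaired_nil, flag_false, List.length_nil,
        zero_mul, zero_add] at h1
      set T1 := Function.update (Function.update (Function.update (Function.update (Function.update T0
        (r .lst) []) (r .A) []) (r .T) []) (r .M) []) (r .P) [] with hT1
      have hM1 : (Sum.elim T1 (file [] v zz [] [] [] [] []) : Regs (κ ⊕ AReg)) (Sum.inl (r .M)) = [] := by simp [hT1]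
      set T2 := Function.update T1 (r .DN) [true] with hT2
      have h2 : Runs (push (Sum.inl (r .DN)) true : Com (κ ⊕ AReg)) (Sum.elim T1 (file [] v zz [] [] [] [] []))
          (Sum.elim T2 (file [] v zz [] [] [] [] [])) 1 :=
        Runs.push' (by simp [-Sum.elim_update_left, -Sum.elim_update_right, hT2, hT1, hne, rD])
      have hI2 : T2 (r .INS) = flag ins := by simp [hT2, hT1, hne, rI]
      cases ins
      · -- emit `v` at the end
        have hA2 : T2 (r .A) = [] := by simp [hT2, hT1, hne]
        have h3 : Runs (copy (Sum.inr AReg.y) (Sum.inl (r .A)) (Sum.inr AReg.s) (Sum.inr AReg.t) : Com (κ ⊕ AReg))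
            (Sum.elim T2 (file [] v zz [] [] [] [] [])) (Sum.elim (Function.update T2 (r .A) v) (file [] v zz [] [] [] [] []))
            (10 * v.length + 3) :=
          (runs_copy (by simp) (by simp) (by simp) (by simp) (by simp) (by simp) _ (by simp) (by simp)).of_eq
            (by simp [-Sum.elim_update_left, -Sum.elim_update_right, hA2]) (by simp)
        have h4 := runs_emit (h := (Sum.inl (r .A) : κ ⊕ AReg)) (o := Sum.inl (r .outR)) (by simp [hne])
          (Sum.elim (Function.update T2 (r .A) v) (file [] v zz [] [] [] [] []))
        simp only [Sum.elim_inl, Function.update_self, Sum.update_elim_inl, Function.update_idem] at h4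
        rw [Function.update_of_ne (hne (by decide))] at h4
        set T4 := Function.update (Function.update T2 (r .A) []) (r .outR)
          (true :: false :: ((v.flatMap fun b => [b, b]).reverse ++ T2 (r .outR))) with hT4
        have h5 : Runs (push (Sum.inl (r .INS)) true : Com (κ ⊕ AReg)) (Sum.elim T4 (file [] v zz [] [] [] [] []))
            (Sum.elim (Function.update T4 (r .INS) [true]) (file [] v zz [] [] [] [] [])) 1 :=
          Runs.push' (by simp [-Sum.elim_update_left, -Sum.elim_update_right, hT4, hne, hI2])
        have hbr : Runs (ifFlag (Sum.inl (r .INS)) skip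
            (copy (Sum.inr AReg.y) (Sum.inl (r .A)) (Sum.inr AReg.s) (Sum.inr AReg.t) ;;
              (emit (Sum.inl (r .A)) (Sum.inl (r .outR)) ;; push (Sum.inl (r .INS)) true)) : Com (κ ⊕ AReg))
            (Sum.elim T2 (file [] v zz [] [] [] [] [])) _ (_ + 3) :=
          runs_ifFlag_false _ (by rw [Sum.elim_inl, hI2]) (h3.seq (h4.seq h5))
        refine (runs_ifFlag_false _ hk0 (h1.seq (Runs.pop_nil _ _ hM1 (h2.seq hbr)))).of_eq ?_ ?_
        · congr 1
          refine eq_ifile r _ _ _ _ ?_ ?_ ?_ ?_ ?_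
          · simp [hT4, hT2, hT1, hne, insAbs]
          · simp [hT4, hT2, hT1, hne, insAbs, rO, outRev_append]
          · simp [hT4, insAbs]
          · simp [hT4, hT2, hne, insAbs]
          · intro k h1 h2 h3 h4
            by_cases kA : k = r .A; · subst kA; simp [hT4, hT2, hT1, hne, hA]
            by_cases kT : k = r .T; · subst kT; simp [hT4, hT2, hT1, hne, hT]
            by_cases kM : k = r .M; · subst kM; simp [hT4, hT2, hT1, hne, hM]
            by_cases kP : k = r .P; · subst kP; simp [hT4, hT2, hT1, hne, hP]
            by_cases kH : k = r .H; · subst kH; simp [hT4, hT2, hT1, hne, hH, rH]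
            rw [show Function.update T4 (r LIx.INS) [true] k = T0 k from by
              simp [hT4, hT2, hT1, h1, h2, h3, h4, kA, kT, kM, kP]]
            exact r0 h1 h2 h3 h4
        · unfold insCost; omega
      · -- already inserted: nothing to emit
        have hbr : Runs (ifFlag (Sum.inl (r .INS)) skip
            (copy (Sum.inr AReg.y) (Sum.inl (r .A)) (Sum.inr AReg.s) (Sum.inr AReg.t) ;;
              (emit (Sum.inl (r .A)) (Sum.inl (r .outR)) ;; push (Sum.inl (r .INS)) true)) : Com (κ ⊕ AReg))
            (Sum.elim T2 (file [] v zz [] [] [] [] [])) _ (0 + 3) :=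
          runs_ifFlag_true _ (by rw [Sum.elim_inl, hI2]) (Runs.skip _)
        refine (runs_ifFlag_false _ hk0 (h1.seq (Runs.pop_nil _ _ hM1 (h2.seq hbr)))).of_eq ?_ ?_
        · congr 1
          refine eq_ifile r _ _ _ _ ?_ ?_ ?_ ?_ ?_
          · simp [hT2, hT1, hne, insAbs]
          · simp [hT2, hT1, hne, insAbs, rO]
          · simp [hT2, hT1, hne, insAbs, rI]
          · simp [hT2, insAbs]
          · intro k h1 h2 h3 h4
            by_cases kA : k = r .A; · subst kA; simp [hT2, hT1, hne, hA]
            by_cases kT : k = r .T; · subst kT; simp [hT2, hT1, hne, hT]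
            by_cases kM : k = r .M; · subst kM; simp [hT2, hT1, hne, hM]
            by_cases kP : k = r .P; · subst kP; simp [hT2, hT1, hne, hP]
            by_cases kH : k = r .H; · subst kH; simp [hT2, hT1, hne, hH, rH]
            rw [show T2 k = T0 k from by simp [hT2, hT1, h1, h4, kA, kT, kM, kP]]
            exact r0 h1 h2 h3 h4
        · unfold insCost; omega
    | cons hd rem =>
      simp only [boolUnpair_encList_cons, wellPaired_encList, ne_eq, reduceCtorEq, not_false_eq_true, decide_true,
        flag_true] at h1
      have hn' : 2 * hd.length + 2 + (encList rem).length ≤ n := by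
        rw [encList_cons, length_boolPair] at hn; exact hn
      set T1 := Function.update (Function.update (Function.update (Function.update (Function.update T0
        (r .lst) []) (r .A) hd.reverse) (r .T) (encList rem).reverse) (r .M) [true]) (r .P) [] with hT1
      have hM1 : (Sum.elim T1 (file [] v zz [] [] [] [] []) : Regs (κ ⊕ AReg)) (Sum.inl (r .M)) = true :: [] := by
        simp [hT1]
      set T1' := Function.update T1 (r .M) [] with hT1'
      have hpop : Function.update (Sum.elim T1 (file [] v zz [] [] [] [] []) : Regs (κ ⊕ AReg)) (Sum.inl (r .M)) [] =
          Sum.elim T1' (file [] v zz [] [] [] [] []) := by rw [Sum.update_elim_inl]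
      -- restore the tail, load the head into the bank and save a copy
      set T2 := Function.update (Function.update T1' (r .T) []) (r .lst) (encList rem) with hT2
      have hp1 : Runs (pour (Sum.inl (r .T)) (Sum.inl (r .lst)) : Com (κ ⊕ AReg)) (Sum.elim T1' (file [] v zz [] [] [] [] []))
          (Sum.elim T2 (file [] v zz [] [] [] [] [])) (3 * (encList rem).length + 1) :=
        (runs_pour (by simp [hne]) _).of_eq (by simp [-Sum.elim_update_left, -Sum.elim_update_right, hT2, hT1', hT1, hne])
          (by simp [hT1', hT1, hne])
      set T3 := Function.update T2 (r .A) [] with hT3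
      have hp2 : Runs (pour (Sum.inl (r .A)) (Sum.inr AReg.x) : Com (κ ⊕ AReg)) (Sum.elim T2 (file [] v zz [] [] [] [] []))
          (Sum.elim T3 (file hd v zz [] [] [] [] [])) (3 * hd.length + 1) :=
        (runs_pour (by simp) _).of_eq (by simp [-Sum.elim_update_left, -Sum.elim_update_right, hT3, hT2, hT1', hT1, hne])
          (by simp [hT2, hT1', hT1, hne])
      have hH3 : T3 (r .H) = [] := by simp [hT3, hT2, hT1', hT1, hne, rH]
      set T4 := Function.update T3 (r .H) hd with hT4
      have hp3 : Runs (copy (Sum.inr AReg.x) (Sum.inl (r .H)) (Sum.inr AReg.s) (Sum.inr AReg.t) : Com (κ ⊕ AReg))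
          (Sum.elim T3 (file hd v zz [] [] [] [] [])) (Sum.elim T4 (file hd v zz [] [] [] [] [])) (10 * hd.length + 3) :=
        (runs_copy (by simp) (by simp) (by simp) (by simp) (by simp) (by simp) _ (by simp) (by simp)).of_eq
          (by simp [-Sum.elim_update_left, -Sum.elim_update_right, hT4, hH3]) (by simp)
      have hI4 : T4 (r .INS) = flag ins := by simp [hT4, hT3, hT2, hT1', hT1, hne, rI]
      have hA4 : T4 (r .A) = [] := by simp [hT4, hT3, hne]
      have hH4 : T4 (r .H) = hd := by simp [hT4]
      have hO4 : T4 (r .outR) = outRev E ++ outR₀ := by simp [hT4, hT3, hT2, hT1', hT1, hne, rO]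
      cases ins
      · -- not yet inserted: compare
        have hsub := (runs_sub hd v zz).inr T4
        rw [subBorrow_iff] at hsub
        by_cases hle : bitsToNat v ≤ bitsToNat hd
        · -- `v ≤ head`: emit `v`, then the head; latch `INS`
          have hnlt : ¬ bitsToNat hd < bitsToNat v := not_lt.2 hle
          simp only [hnlt, decide_false, cond_false, Bool.not_false, flag_true] at hsub
          have hg : (Sum.elim T4 (file (subRes hd v) v zz [] [] [] [] [true]) : Regs (κ ⊕ AReg)) (Sum.inr AReg.g) = true :: [] := rfl
          have hpopg : Function.update (Sum.elim T4 (file (subRes hd v) v zz [] [] [] [] [true]) : Regs (κ ⊕ AReg))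
              (Sum.inr AReg.g) [] = Sum.elim T4 (file (subRes hd v) v zz [] [] [] [] []) := by simp
          have hvh := runs_emitVH r T4 (subRes hd v) v zz hA4 (by rw [hI4]; rfl)
          rw [hH4, hO4, length_subRes] at hvh
          refine (runs_ifFlag_false _ hk0 (h1.seq (Runs.pop_true' _ _ hM1 hpop (hp1.seq (hp2.seq (hp3.seq
            (runs_ifFlag_false _ (by rw [Sum.elim_inl, hI4]) (hsub.seq (Runs.pop_true' _ _ hg hpopg hvh))))))))).of_eq
            ?_ ?_
          · congr 1
            refine eq_ifile r _ _ _ _ ?_ ?_ ?_ ?_ ?_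
            · simp [hT4, hT3, hT2, hne, insAbs, hle]
            · simp [hne, insAbs, hle, outRev_append_two]
            · simp [insAbs, hle]
            · simp [hT4, hT3, hT2, hT1', hT1, hne, insAbs, hle, rD]
            · intro k h1 h2 h3 h4
              by_cases kA : k = r .A; · subst kA; simp [hT4, hT3, hT2, hT1', hT1, hne, hA]
              by_cases kT : k = r .T; · subst kT; simp [hT4, hT3, hT2, hT1', hT1, hne, hT]
              by_cases kM : k = r .M; · subst kM; simp [hT4, hT3, hT2, hT1', hT1, hne, hM]
              by_cases kP : k = r .P; · subst kP; simp [hT4, hT3, hT2, hT1', hT1, hne, hP]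
              by_cases kH : k = r .H; · subst kH; simp [hT4, hT3, hT2, hT1', hT1, hne, hH]
              rw [show Function.update (Function.update (Function.update T4 (r LIx.H) []) (r LIx.outR) (true :: false :: ((hd.flatMap fun b => [b, b]).reverse ++ (true :: false :: ((v.flatMap fun b => [b, b]).reverse ++ (outRev E ++ outR₀)))))) (r LIx.INS) [true] k = T0 k from by simp [hT4, hT3, hT2, hT1', hT1, h1, h2, h3, kH, kA, kT, kM, kP]]
              exact r0 h1 h2 h3 h4
          · have hj : (encList (hd :: rem)).length = 2 * hd.length + 2 + (encList rem).length := by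
              rw [encList_cons, length_boolPair]
            unfold insCost; omega
        · -- `head < v`: emit the head only
          have hlt : bitsToNat hd < bitsToNat v := not_le.1 hle
          simp only [hlt, decide_true, cond_true, Bool.not_true, flag_false] at hsub
          have hg : (Sum.elim T4 (file hd v zz [] [] [] [] []) : Regs (κ ⊕ AReg)) (Sum.inr AReg.g) = [] := rfl
          have heh := runs_emitH r T4 hd v zz
          rw [hH4, hO4] at heh
          refine (runs_ifFlag_false _ hk0 (h1.seq (Runs.pop_true' _ _ hM1 hpop (hp1.seq (hp2.seq (hp3.seq
            (runs_ifFlag_false _ (by rw [Sum.elim_inl, hI4]) (hsub.seq (Runs.pop_nil _ _ hg heh))))))))).of_eq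
            ?_ ?_
          · congr 1
            refine eq_ifile r _ _ _ _ ?_ ?_ ?_ ?_ ?_
            · simp [hT4, hT3, hT2, hne, insAbs, hle]
            · simp [insAbs, hle, outRev_append]
            · simp [hT4, hT3, hT2, hT1', hT1, hne, insAbs, hle, rI]
            · simp [hT4, hT3, hT2, hT1', hT1, hne, insAbs, hle, rD]
            · intro k h1 h2 h3 h4
              by_cases kA : k = r .A; · subst kA; simp [hT4, hT3, hT2, hT1', hT1, hne, hA]
              by_cases kT : k = r .T; · subst kT; simp [hT4, hT3, hT2, hT1', hT1, hne, hT]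
              by_cases kM : k = r .M; · subst kM; simp [hT4, hT3, hT2, hT1', hT1, hne, hM]
              by_cases kP : k = r .P; · subst kP; simp [hT4, hT3, hT2, hT1', hT1, hne, hP]
              by_cases kH : k = r .H; · subst kH; simp [hT4, hT3, hT2, hT1', hT1, hne, hH]
              rw [show Function.update (Function.update T4 (r LIx.H) []) (r LIx.outR) (true :: false :: ((hd.flatMap fun b => [b, b]).reverse ++ (outRev E ++ outR₀))) k = T0 k from by simp [hT4, hT3, hT2, hT1', hT1, h1, h2, kH, kA, kT, kM, kP]]
              exact r0 h1 h2 h3 h4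
          · have hj : (encList (hd :: rem)).length = 2 * hd.length + 2 + (encList rem).length := by
              rw [encList_cons, length_boolPair]
            unfold insCost; omega
      · -- already inserted: emit the head
        have heh := runs_emitH r T4 hd v zz
        rw [hH4, hO4] at heh
        refine (runs_ifFlag_false _ hk0 (h1.seq (Runs.pop_true' _ _ hM1 hpop (hp1.seq (hp2.seq (hp3.seq
          (runs_ifFlag_true _ (by rw [Sum.elim_inl, hI4]) heh))))))).of_eq ?_ ?_
        · congr 1
          refine eq_ifile r _ _ _ _ ?_ ?_ ?_ ?_ ?_
          · simp [hT4, hT3, hT2, hne, insAbs]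
          · simp [insAbs, outRev_append]
          · simp [hT4, hT3, hT2, hT1', hT1, hne, insAbs, rI]
          · simp [hT4, hT3, hT2, hT1', hT1, hne, insAbs, rD]
          · intro k h1 h2 h3 h4
            by_cases kA : k = r .A; · subst kA; simp [hT4, hT3, hT2, hT1', hT1, hne, hA]
            by_cases kT : k = r .T; · subst kT; simp [hT4, hT3, hT2, hT1', hT1, hne, hT]
            by_cases kM : k = r .M; · subst kM; simp [hT4, hT3, hT2, hT1', hT1, hne, hM]
            by_cases kP : k = r .P; · subst kP; simp [hT4, hT3, hT2, hT1', hT1, hne, hP]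
            by_cases kH : k = r .H; · subst kH; simp [hT4, hT3, hT2, hT1', hT1, hne, hH]
            rw [show Function.update (Function.update T4 (r LIx.H) []) (r LIx.outR) (true :: false :: ((hd.flatMap fun b => [b, b]).reverse ++ (outRev E ++ outR₀))) k = T0 k from by simp [hT4, hT3, hT2, hT1', hT1, h1, h2, kH, kA, kT, kM, kP]]
            exact r0 h1 h2 h3 h4
        · have hj : (encList (hd :: rem)).length = 2 * hd.length + 2 + (encList rem).length := by
            rw [encList_cons, length_boolPair]
          unfold insCost; omega
  · -- done: skip
    refine (runs_ifFlag_true _ (by rw [Sum.elim_inl, rD]) (Runs.skip _)).of_eq ?_ hC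
    rw [hT0]; simp [insAbs]

end InsertStep


section InsertLoop

variable {κ : Type} [DecidableEq κ] (r : LIx ↪ κ)

/-- A done state is fixed by the abstract step. [folklore] -/
theorem insAbs_done (v : List Bool) (st : InsState) (h : st.dn = true) : insAbs v st = st := by
  simp [insAbs, h]

/-- **The abstract insertion run**: from `⟨l, E, ins, not done⟩`, after `k ≥ |l| + 1` steps the
state is done with `E ++ l` emitted if `v` was already inserted, and `E ++ insModel v l`
otherwise. [folklore] -/
theorem insAbs_iterate (v : List Bool) : ∀ (l E : List (List Bool)) (ins : Bool) (k : ℕ), l.length + 1 ≤ k →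
    (insAbs v)^[k] ⟨l, E, ins, false⟩ =
      ⟨[], E ++ (if ins then l else insModel v l), true, true⟩
  | [], E, ins, k, hk => by
    obtain ⟨k, rfl⟩ : ∃ k', k = k' + 1 := ⟨k - 1, by omega⟩
    rw [Function.iterate_succ_apply]
    have h1 : insAbs v ⟨[], E, ins, false⟩ = ⟨[], if ins then E else E ++ [v], true, true⟩ := by
      simp [insAbs]
    rw [h1, Function.iterate_fixed (insAbs_done v _ rfl)]
    cases ins <;> simp [insModel]
  | h :: l, E, ins, k, hk => by
    obtain ⟨k, rfl⟩ : ∃ k', k = k' + 1 := ⟨k - 1, by omega⟩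
    rw [Function.iterate_succ_apply]
    cases ins
    · by_cases hle : bitsToNat v ≤ bitsToNat h
      · have h1 : insAbs v ⟨h :: l, E, false, false⟩ = ⟨l, E ++ [v, h], true, false⟩ := by simp [insAbs, hle]
        rw [h1, insAbs_iterate v l _ true k (by simp at hk; omega)]
        simp [insModel, List.orderedInsert, hle]
      · have h1 : insAbs v ⟨h :: l, E, false, false⟩ = ⟨l, E ++ [h], false, false⟩ := by simp [insAbs, hle]
        rw [h1, insAbs_iterate v l _ false k (by simp at hk; omega)]
        simp [insModel, List.orderedInsert, hle]
    · have h1 : insAbs v ⟨h :: l, E, true, false⟩ = ⟨l, E ++ [h], true, false⟩ := by simp [insAbs]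
      rw [h1, insAbs_iterate v l _ true k (by simp at hk; omega)]
      simp

/-- The coded list never grows along the run. [folklore] -/
theorem length_encList_insAbs_le (v : List Bool) (st : InsState) :
    (encList (insAbs v st).rem).length ≤ (encList st.rem).length := by
  obtain ⟨rem, E, ins, dn⟩ := st
  cases dn
  · cases rem with
    | nil => simp [insAbs]
    | cons h rem =>
      cases ins
      · by_cases hle : bitsToNat v ≤ bitsToNat h <;>
          simp [insAbs, hle, encList_cons, length_boolPair]
      · simp [insAbs, encList_cons, length_boolPair]
  · simp [insAbs]

/-- Iterating keeps the coded list short. [folklore] -/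
theorem length_encList_iterate_le (v : List Bool) : ∀ (k : ℕ) (st : InsState),
    (encList ((insAbs v)^[k] st).rem).length ≤ (encList st.rem).length
  | 0, st => le_rfl
  | k + 1, st => by
    rw [Function.iterate_succ_apply]
    exact (length_encList_iterate_le v k _).trans (length_encList_insAbs_le v st)

/-- **Simulation of the clocked insertion loop**: one `insStep` per bit of `F`, following the
abstract run. [folklore] -/
theorem runs_insLoop (B : Regs κ) (outR₀ v zz : List Bool) (n : ℕ)
    (hA : B (r .A) = []) (hT : B (r .T) = []) (hM : B (r .M) = []) (hP : B (r .P) = [])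
    (hH : B (r .H) = []) :
    ∀ (ws : List Bool) (st : InsState), B (r .F) = ws → (encList st.rem).length ≤ n →
      Runs (loop (Sum.inl (r .F)) (insStep r) (insStep r))
        (Sum.elim (ifile r B outR₀ st) (file [] v zz [] [] [] [] []))
        (Sum.elim (ifile r (Function.update B (r .F) []) outR₀ ((insAbs v)^[ws.length] st)) (file [] v zz [] [] [] [] []))
        (ws.length * (insCost n v.length + 2) + 1)
  | [], st, hF, _ => by
    have hne : ∀ {i j : LIx}, i ≠ j → r i ≠ r j := fun h => r.injective.ne h
    refine (Runs.loop_nil _ _ (by simp [ifile, hne, hF])).of_eq ?_ (by simp)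
    rw [Function.update_eq_self_iff.2 hF.symm]; rfl
  | w :: ws, st, hF, hn => by
    have hne : ∀ {i j : LIx}, i ≠ j → r i ≠ r j := fun h => r.injective.ne h
    have hk : (Sum.elim (ifile r B outR₀ st) (file [] v zz [] [] [] [] []) : Regs (κ ⊕ AReg)) (Sum.inl (r .F)) = w :: ws := by
      simp [ifile, hne, hF]
    have hupd : Function.update (Sum.elim (ifile r B outR₀ st) (file [] v zz [] [] [] [] []) : Regs (κ ⊕ AReg))
        (Sum.inl (r .F)) ws = Sum.elim (ifile r (Function.update B (r .F) ws) outR₀ st) (file [] v zz [] [] [] [] []) := by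
      rw [Sum.update_elim_inl]
      congr 1
      funext k
      by_cases h1 : k = r .F
      · subst h1; simp [ifile, hne]
      · simp [ifile, Function.update_apply, h1]
    have hbody := runs_insStep r (Function.update B (r .F) ws) outR₀ v zz st n (by simp [hne, hA]) (by simp [hne, hT])
      (by simp [hne, hM]) (by simp [hne, hP]) (by simp [hne, hH]) hn
    rw [← hupd] at hbody
    have hrest := runs_insLoop (Function.update B (r .F) ws) outR₀ v zz n (by simp [hne, hA]) (by simp [hne, hT])
      (by simp [hne, hM]) (by simp [hne, hP]) (by simp [hne, hH]) ws (insAbs v st) (by simp)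
      ((length_encList_insAbs_le v st).trans hn)
    rw [Function.update_idem] at hrest
    rw [List.length_cons, Function.iterate_succ_apply]
    cases w
    · exact (Runs.loop_false hk hbody hrest).of_eq rfl (by ring_nf; omega)
    · exact (Runs.loop_true hk hbody hrest).of_eq rfl (by ring_nf; omega)

end InsertLoop


section InsertWrap

variable {κ : Type} [DecidableEq κ] (r : LIx ↪ κ)

/-- A coded list is at least as long as the list. [folklore] -/
theorem length_le_length_encList (l : List (List Bool)) : l.length ≤ (encList l).length := by
  induction l with
  | nil => simp
  | cons a l ih => rw [encList_cons, length_boolPair, List.length_cons]; omega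

/-- **Simulation of `insertSorted`**: from a base with `lst = encList l` (sorted or not),
`outR = outR₀`, the latches and the step registers empty, and the bank holding `x = 0`, `y = v`,
the routine ends in the insertion file of the done state: `lst = []`,
`outR = outRev (insModel v l) ++ outR₀`, both latches set; cost
`(|encList l| + 1) · (insCost |encList l| |v| + 2) + 10 |encList l| + 5`. [cite: CLRS2009, §2.1 (INSERTION-SORT, inner loop)] -/
theorem runs_insertSorted (B : Regs κ) (outR₀ v zz : List Bool) (l : List (List Bool))
    (hA : B (r .A) = []) (hT : B (r .T) = []) (hM : B (r .M) = []) (hP : B (r .P) = []) (hH : B (r .H) = [])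
    (hF : B (r .F) = []) (hL : B (r .lst) = encList l) (hO : B (r .outR) = outR₀) (hI : B (r .INS) = [])
    (hD : B (r .DN) = []) :
    Runs (insertSorted r) (Sum.elim B (file [] v zz [] [] [] [] []))
      (Sum.elim (ifile r B outR₀ ⟨[], insModel v l, true, true⟩) (file [] v zz [] [] [] [] []))
      (((encList l).length + 1) * (insCost (encList l).length v.length + 2) + 10 * (encList l).length + 5) := by
  have hne : ∀ {i j : LIx}, i ≠ j → r i ≠ r j := fun h => r.injective.ne h
  set L := encList l with hLdef
  have h1 : Runs (copy (Sum.inl (r .lst)) (Sum.inl (r .F)) (Sum.inr AReg.s) (Sum.inr AReg.t) : Com (κ ⊕ AReg))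
      (Sum.elim B (file [] v zz [] [] [] [] [])) (Sum.elim (Function.update B (r .F) L) (file [] v zz [] [] [] [] []))
      (10 * L.length + 3) :=
    (runs_copy (by simp [hne]) (by simp) (by simp) (by simp) (by simp) (by simp) _ (by simp) (by simp)).of_eq
      (by simp [-Sum.elim_update_left, -Sum.elim_update_right, hL, hF, hLdef]) (by simp [hL, hLdef])
  set B' := Function.update B (r .F) (true :: L) with hB'
  have h2 : Runs (push (Sum.inl (r .F)) true : Com (κ ⊕ AReg)) (Sum.elim (Function.update B (r .F) L) (file [] v zz [] [] [] [] []))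
      (Sum.elim B' (file [] v zz [] [] [] [] [])) 1 :=
    Runs.push' (by simp [-Sum.elim_update_left, -Sum.elim_update_right, hB'])
  have hst : B' = ifile r B' outR₀ ⟨l, [], false, false⟩ :=
    eq_ifile r _ _ _ _ (by simp [hB', hne, hL, hLdef]) (by simp [hB', hne, hO]) (by simp [hB', hne, hI])
      (by simp [hB', hne, hD]) (fun _ _ _ _ _ => rfl)
  have h3 := runs_insLoop r B' outR₀ v zz L.length (by simp [hB', hne, hA]) (by simp [hB', hne, hT])
    (by simp [hB', hne, hM]) (by simp [hB', hne, hP]) (by simp [hB', hne, hH]) (true :: L) ⟨l, [], false, false⟩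
    (by simp [hB']) (by simp [hLdef])
  rw [← hst] at h3
  have hiter := insAbs_iterate v l [] false (true :: L).length
    (by simp only [List.length_cons, hLdef]; exact Nat.succ_le_succ (length_le_length_encList l))
  simp only [Bool.false_eq_true, if_false, List.nil_append] at hiter
  rw [hiter] at h3
  have hB'' : Function.update B' (r .F) ([] : List Bool) = B := by
    rw [hB', Function.update_idem]; exact Function.update_eq_self_iff.2 hF.symm
  rw [hB''] at h3
  refine (h1.seq (h2.seq h3)).of_eq rfl ?_
  simp only [List.length_cons]
  ring_nf; omega

end InsertWrap


section SortProg

variable {κ : Type} [DecidableEq κ] (r : LIx ↪ κ)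

/-- Un-reversing an emitted prefix gives the coded list. [folklore] -/
theorem reverse_outRev (E : List (List Bool)) : (outRev E).reverse = encList E := by
  rw [outRev, List.reverse_reverse, encList_eq_flatMap]

/-- One clocked step of insertion sort: take the next element of `src` into the bank (`y`),
insert it into the sorted list `lst` (`insertSorted`), un-reverse the result back into `lst`,
reset the latches. [cite: CLRS2009, §2.1 (INSERTION-SORT)] -/
def isortStep : Com (κ ⊕ AReg) :=
  unpairW (Sum.inl (r .src)) (Sum.inl (r .A)) (Sum.inl (r .T)) (Sum.inl (r .M)) (Sum.inl (r .P)) ;;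
    pop (Sum.inl (r .M))
      (pour (Sum.inl (r .T)) (Sum.inl (r .src)) ;;
        (bk (clear .y) ;;
        (pour (Sum.inl (r .A)) (Sum.inr .y) ;;
        (insertSorted r ;;
        (pour (Sum.inl (r .outR)) (Sum.inl (r .lst)) ;;
        (clear (Sum.inl (r .INS)) ;; clear (Sum.inl (r .DN))))))))
      skip skip

/-- `isort r`: **insertion sort** of the coded list in `src` (consumed) onto the sorted coded
list in `lst`, clocked by `|src| + 1` steps in `F2`. [cite: CLRS2009, §2.1 (INSERTION-SORT)] -/
def isort : Com (κ ⊕ AReg) :=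
  copy (Sum.inl (r .src)) (Sum.inl (r .F2)) (Sum.inr .s) (Sum.inr .t) ;;
    (push (Sum.inl (r .F2)) true ;; loop (Sum.inl (r .F2)) (isortStep r) (isortStep r))

/-- Model of one sorting step on (remaining input, sorted accumulator, bank `y`). [folklore] -/
def isortAbs (st : List (List Bool) × List (List Bool) × List Bool) : List (List Bool) × List (List Bool) × List Bool :=
  match st.1 with
  | [] => st
  | e :: rem => (rem, insModel e st.2.1, e)

/-- Model of the whole sort from an accumulator: insert the elements in order. [folklore] -/
def isortModel (acc : List (List Bool)) (l : List (List Bool)) : List (List Bool) :=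
  l.foldl (fun a e => insModel e a) acc

/-- The abstract sorting run. [folklore] -/
theorem isortAbs_iterate : ∀ (l acc : List (List Bool)) (yc : List Bool) (k : ℕ), l.length ≤ k →
    ((isortAbs^[k]) (l, acc, yc)).1 = [] ∧ ((isortAbs^[k]) (l, acc, yc)).2.1 = isortModel acc l
  | [], acc, yc, k, _ => by
    have : isortAbs^[k] (([] : List (List Bool)), acc, yc) = ([], acc, yc) :=
      Function.iterate_fixed (by simp [isortAbs]) k
    simp [this, isortModel]
  | e :: l, acc, yc, k, hk => by
    obtain ⟨k, rfl⟩ : ∃ k', k = k' + 1 := ⟨k - 1, by simp at hk; omega⟩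
    rw [Function.iterate_succ_apply]
    simp only [isortAbs]
    have := isortAbs_iterate l (insModel e acc) e k (by simp at hk; omega)
    simpa [isortModel] using this

/-- The register file of a sorting state over a base `B`. [folklore] -/
def jfile (B : Regs κ) (st : List (List Bool) × List (List Bool) × List Bool) : Regs κ :=
  Function.update (Function.update B (r .src) (encList st.1)) (r .lst) (encList st.2.1)

/-- The size of a sorting state: bits of input plus bits of accumulator (constant along the run,
`size_isortAbs`). [folklore] -/
def jsize (st : List (List Bool) × List (List Bool) × List Bool) : ℕ :=
  (encList st.1).length + (encList st.2.1).length

/-- Inserting an element adds its code to the accumulator. [folklore] -/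
theorem length_encList_insModel (e : List Bool) (acc : List (List Bool)) :
    (encList (insModel e acc)).length = (encList acc).length + (2 * e.length + 2) := by
  have hperm : (insModel e acc).Perm (e :: acc) := List.perm_orderedInsert _ _ _
  rw [length_encList, length_encList, (hperm.map _).sum_eq]
  simp; ring

/-- The size is invariant and bounds the bank element. [folklore] -/
theorem size_isortAbs (st : List (List Bool) × List (List Bool) × List Bool) :
    jsize (isortAbs st) = jsize st ∧ ((isortAbs st).2.2.length ≤ jsize st ∨ (isortAbs st).2.2 = st.2.2) := by
  obtain ⟨l, acc, yc⟩ := st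
  cases l with
  | nil => simp [isortAbs]
  | cons e l =>
    simp only [isortAbs, jsize, length_encList_insModel, encList_cons, length_boolPair]
    constructor
    · omega
    · left; omega

/-- Cost of one sorting step at size `S`. [folklore] -/
def isortStepCost (S : ℕ) : ℕ := (S + 1) * (insCost S S + 2) + 28 * S + 24

end SortProg


section SortRuns

variable {κ : Type} [DecidableEq κ] (r : LIx ↪ κ)

/-- The step cost is monotone. [folklore] -/
theorem insCost_mono {n n' m m' : ℕ} (hn : n ≤ n') (hm : m ≤ m') : insCost n m ≤ insCost n' m' := by
  unfold insCost; omega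

/-- A register file is the sorting file `jfile …` if it reads accordingly. [folklore] -/
theorem eq_jfile (T B : Regs κ) (st : List (List Bool) × List (List Bool) × List Bool)
    (hs : T (r .src) = encList st.1) (hl : T (r .lst) = encList st.2.1)
    (hrest : ∀ k, k ≠ r .src → k ≠ r .lst → T k = B k) : T = jfile r B st := by
  have hne : ∀ {i j : LIx}, i ≠ j → r i ≠ r j := fun h => r.injective.ne h
  funext k
  by_cases h1 : k = r .lst; · subst h1; simp [jfile, hl]
  by_cases h2 : k = r .src; · subst h2; simp [jfile, hs, hne]
  rw [hrest k h2 h1]; simp [jfile, h1, h2]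

/-- **Simulation of one sorting step** (see `isortStep`, model `isortAbs`). [folklore] -/
theorem runs_isortStep (B : Regs κ) (zz : List Bool) (st : List (List Bool) × List (List Bool) × List Bool) (S : ℕ)
    (hA : B (r .A) = []) (hT : B (r .T) = []) (hM : B (r .M) = []) (hP : B (r .P) = []) (hH : B (r .H) = [])
    (hF : B (r .F) = []) (hO : B (r .outR) = []) (hI : B (r .INS) = []) (hD : B (r .DN) = [])
    (hsize : jsize st ≤ S) (hy : st.2.2.length ≤ S) :
    Runs (isortStep r) (Sum.elim (jfile r B st) (file [] st.2.2 zz [] [] [] [] []))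
      (Sum.elim (jfile r B (isortAbs st)) (file [] (isortAbs st).2.2 zz [] [] [] [] [])) (isortStepCost S) := by
  have hne : ∀ {i j : LIx}, i ≠ j → r i ≠ r j := fun h => r.injective.ne h
  obtain ⟨rem, acc, yc⟩ := st
  simp only [jsize] at hsize hy
  set T0 := jfile r B (rem, acc, yc) with hT0
  have r0 : ∀ {k : κ}, k ≠ r .src → k ≠ r .lst → T0 k = B k := fun h1 h2 => by simp [hT0, jfile, h1, h2]
  have rS : T0 (r .src) = encList rem := by simp [hT0, jfile, hne]
  have rL : T0 (r .lst) = encList acc := by simp [hT0, jfile]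
  have rd : ∀ i : LIx, i ≠ .src → i ≠ .lst → T0 (r i) = B (r i) := fun i h1 h2 => r0 (hne h1) (hne h2)
  have hC : 9 ≤ isortStepCost S := by unfold isortStepCost; omega
  have hnd : [(Sum.inl (r .src) : κ ⊕ AReg), Sum.inl (r .A), Sum.inl (r .T), Sum.inl (r .M), Sum.inl (r .P)].Nodup := by
    simp [hne]
  have h1 := runs_unpairW hnd (Sum.elim T0 (file [] yc zz [] [] [] [] []))
    (by rw [Sum.elim_inl, rd _ (by decide) (by decide), hM]) (by rw [Sum.elim_inl, rd _ (by decide) (by decide), hP])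
  simp only [Sum.elim_inl, rS, rd LIx.A (by decide) (by decide), rd LIx.T (by decide) (by decide), hA, hT,
    List.append_nil, Sum.update_elim_inl] at h1
  cases rem with
  | nil =>
    simp only [encList_nil, boolUnpair, List.reverse_nil, wellPaired_nil, flag_false, List.length_nil,
      zero_mul, zero_add] at h1
    set T1 := Function.update (Function.update (Function.update (Function.update (Function.update T0
      (r .src) []) (r .A) []) (r .T) []) (r .M) []) (r .P) [] with hT1
    have hM1 : (Sum.elim T1 (file [] yc zz [] [] [] [] []) : Regs (κ ⊕ AReg)) (Sum.inl (r .M)) = [] := by simp [hT1]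
    refine (h1.seq (Runs.pop_nil _ _ hM1 (Runs.skip _))).of_eq ?_ hC
    simp only [isortAbs]
    congr 1
    refine eq_jfile r _ _ _ (by simp [hT1, hne]) (by simp [hT1, hne, rL]) ?_
    intro k h1 h2
    by_cases kA : k = r .A; · subst kA; simp [hT1, hne, hA]
    by_cases kT : k = r .T; · subst kT; simp [hT1, hne, hT]
    by_cases kM : k = r .M; · subst kM; simp [hT1, hne, hM]
    by_cases kP : k = r .P; · subst kP; simp [hT1, hP]
    rw [show T1 k = T0 k from by simp [hT1, h1, kA, kT, kM, kP]]
    exact r0 h1 h2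
  | cons e rem =>
    simp only [boolUnpair_encList_cons, wellPaired_encList, ne_eq, reduceCtorEq, not_false_eq_true, decide_true,
      flag_true] at h1
    have hn' : 2 * e.length + 2 + (encList rem).length + (encList acc).length ≤ S := by
      rw [encList_cons, length_boolPair] at hsize; exact hsize
    set T1 := Function.update (Function.update (Function.update (Function.update (Function.update T0
      (r .src) []) (r .A) e.reverse) (r .T) (encList rem).reverse) (r .M) [true]) (r .P) [] with hT1
    have hM1 : (Sum.elim T1 (file [] yc zz [] [] [] [] []) : Regs (κ ⊕ AReg)) (Sum.inl (r .M)) = true :: [] := by simp [hT1]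
    set T1' := Function.update T1 (r .M) [] with hT1'
    have hpop : Function.update (Sum.elim T1 (file [] yc zz [] [] [] [] []) : Regs (κ ⊕ AReg)) (Sum.inl (r .M)) [] =
        Sum.elim T1' (file [] yc zz [] [] [] [] []) := by rw [Sum.update_elim_inl]
    set T2 := Function.update (Function.update T1' (r .T) []) (r .src) (encList rem) with hT2
    have hp1 : Runs (pour (Sum.inl (r .T)) (Sum.inl (r .src)) : Com (κ ⊕ AReg)) (Sum.elim T1' (file [] yc zz [] [] [] [] []))
        (Sum.elim T2 (file [] yc zz [] [] [] [] [])) (3 * (encList rem).length + 1) :=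
      (runs_pour (by simp [hne]) _).of_eq (by simp [-Sum.elim_update_left, -Sum.elim_update_right, hT2, hT1', hT1, hne])
        (by simp [hT1', hT1, hne])
    have hp2 : Runs (bk (clear .y) : Com (κ ⊕ AReg)) (Sum.elim T2 (file [] yc zz [] [] [] [] []))
        (Sum.elim T2 (file [] [] zz [] [] [] [] [])) (2 * yc.length + 1) :=
      ((runs_clear AReg.y (file [] yc zz [] [] [] [] [])).inr T2).of_eq (by simp) (by simp)
    set T3 := Function.update T2 (r .A) [] with hT3
    have hp3 : Runs (pour (Sum.inl (r .A)) (Sum.inr AReg.y) : Com (κ ⊕ AReg)) (Sum.elim T2 (file [] [] zz [] [] [] [] []))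
        (Sum.elim T3 (file [] e zz [] [] [] [] [])) (3 * e.length + 1) :=
      (runs_pour (by simp) _).of_eq (by simp [-Sum.elim_update_left, -Sum.elim_update_right, hT3, hT2, hT1', hT1, hne])
        (by simp [hT2, hT1', hT1, hne])
    have r3 : ∀ i : LIx, i ≠ .A → i ≠ .src → i ≠ .T → i ≠ .M → i ≠ .P → T3 (r i) = T0 (r i) := by
      intro i h1 h2 h3 h4 h5; simp [hT3, hT2, hT1', hT1, hne, h1, h2, h3, h4, h5]
    have hp4 := runs_insertSorted r T3 [] e zz acc (by simp [hT3]) (by simp [hT3, hT2, hne])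
      (by simp [hT3, hT2, hT1', hne]) (by simp [hT3, hT2, hT1', hT1, hne])
      (by rw [r3 _ (by decide) (by decide) (by decide) (by decide) (by decide), rd _ (by decide) (by decide), hH])
      (by rw [r3 _ (by decide) (by decide) (by decide) (by decide) (by decide), rd _ (by decide) (by decide), hF])
      (by rw [r3 _ (by decide) (by decide) (by decide) (by decide) (by decide), rL])
      (by rw [r3 _ (by decide) (by decide) (by decide) (by decide) (by decide), rd _ (by decide) (by decide), hO])
      (by rw [r3 _ (by decide) (by decide) (by decide) (by decide) (by decide), rd _ (by decide) (by decide), hI])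
      (by rw [r3 _ (by decide) (by decide) (by decide) (by decide) (by decide), rd _ (by decide) (by decide), hD])
    set T4 := ifile r T3 [] ⟨[], insModel e acc, true, true⟩ with hT4
    have r4O : T4 (r .outR) = outRev (insModel e acc) := by simp [hT4, ifile, hne]
    have r4L : T4 (r .lst) = [] := by simp [hT4, ifile, hne]
    set T5 := Function.update (Function.update T4 (r .outR) []) (r .lst) (encList (insModel e acc)) with hT5
    have hp5 : Runs (pour (Sum.inl (r .outR)) (Sum.inl (r .lst)) : Com (κ ⊕ AReg)) (Sum.elim T4 (file [] e zz [] [] [] [] []))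
        (Sum.elim T5 (file [] e zz [] [] [] [] [])) (3 * (encList (insModel e acc)).length + 1) :=
      (runs_pour (by simp [hne]) _).of_eq
        (by simp [-Sum.elim_update_left, -Sum.elim_update_right, hT5, r4O, r4L, reverse_outRev])
        (by simp [r4O, outRev, encList_eq_flatMap])
    have hp6 : Runs (clear (Sum.inl (r .INS)) : Com (κ ⊕ AReg)) (Sum.elim T5 (file [] e zz [] [] [] [] []))
        (Sum.elim (Function.update T5 (r .INS) []) (file [] e zz [] [] [] [] [])) 3 :=
      (runs_clear _ _).of_eq (by simp [-Sum.elim_update_left, -Sum.elim_update_right])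
        (by simp [hT5, hT4, ifile, hne])
    have hp7 : Runs (clear (Sum.inl (r .DN)) : Com (κ ⊕ AReg)) (Sum.elim (Function.update T5 (r .INS) []) (file [] e zz [] [] [] [] []))
        (Sum.elim (Function.update (Function.update T5 (r .INS) []) (r .DN) []) (file [] e zz [] [] [] [] [])) 3 :=
      (runs_clear _ _).of_eq (by simp [-Sum.elim_update_left, -Sum.elim_update_right])
        (by simp [hT5, hT4, ifile, hne])
    refine (h1.seq (Runs.pop_true' _ _ hM1 hpop (hp1.seq (hp2.seq (hp3.seq (hp4.seq (hp5.seq (hp6.seq hp7)))))))).of_eq ?_ ?_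
    · simp only [isortAbs]
      congr 1
      refine eq_jfile r _ _ _ (by simp [hT5, hT4, ifile, hne, hT3, hT2]) (by simp [hT5]) ?_
      intro k h1 h2
      by_cases kD : k = r .DN; · subst kD; simp [hD]
      by_cases kI : k = r .INS; · subst kI; simp [hne, hI]
      by_cases kO : k = r .outR; · subst kO; simp [hT5, hne, hO]
      rw [show Function.update (Function.update T5 (r LIx.INS) []) (r LIx.DN) [] k = T3 k from by
        simp [hT5, hT4, ifile, kD, kI, kO, h2]]
      by_cases kA : k = r .A; · subst kA; simp [hT3, hA]
      by_cases kT : k = r .T; · subst kT; simp [hT3, hT2, hne, hT]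
      by_cases kM : k = r .M; · subst kM; simp [hT3, hT2, hT1', hne, hM]
      by_cases kP : k = r .P; · subst kP; simp [hT3, hT2, hT1', hT1, hne, hP]
      rw [show T3 k = T0 k from by simp [hT3, hT2, hT1', hT1, kA, h1, kT, kM, kP]]
      exact r0 h1 h2
    · have hm := Nat.mul_le_mul (Nat.succ_le_succ (show (encList acc).length ≤ S by omega))
        (Nat.add_le_add_right (insCost_mono (show (encList acc).length ≤ S by omega) (show e.length ≤ S by omega)) 2)
      have hins : (encList (insModel e acc)).length = (encList acc).length + (2 * e.length + 2) :=
        length_encList_insModel e acc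
      unfold isortStepCost
      generalize ((encList acc).length + 1) * (insCost (encList acc).length e.length + 2) = Q1 at hm ⊢
      generalize (S + 1) * (insCost S S + 2) = Q2 at hm ⊢
      omega

end SortRuns


section SortLoop

variable {κ : Type} [DecidableEq κ] (r : LIx ↪ κ)

/-- Iterated sorting steps keep the size and the bank-element bound. [folklore] -/
theorem size_isortAbs_iterate (S : ℕ) : ∀ (k : ℕ) (st : List (List Bool) × List (List Bool) × List Bool),
    jsize st ≤ S → st.2.2.length ≤ S → jsize (isortAbs^[k] st) ≤ S ∧ (isortAbs^[k] st).2.2.length ≤ S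
  | 0, st, h1, h2 => ⟨h1, h2⟩
  | k + 1, st, h1, h2 => by
    rw [Function.iterate_succ_apply]
    obtain ⟨hs, hy⟩ := size_isortAbs st
    refine size_isortAbs_iterate S k _ (hs ▸ h1) ?_
    rcases hy with hy | hy
    · exact hy.trans h1
    · rw [hy]; exact h2

/-- **Simulation of the clocked sorting loop**: one `isortStep` per bit of `F2`. [folklore] -/
theorem runs_isortLoop (zz : List Bool) (S : ℕ) :
    ∀ (ws : List Bool) (B : Regs κ) (st : List (List Bool) × List (List Bool) × List Bool),
      B (r .A) = [] → B (r .T) = [] → B (r .M) = [] → B (r .P) = [] → B (r .H) = [] → B (r .F) = [] →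
      B (r .outR) = [] → B (r .INS) = [] → B (r .DN) = [] → B (r .F2) = ws → jsize st ≤ S → st.2.2.length ≤ S →
      Runs (loop (Sum.inl (r .F2)) (isortStep r) (isortStep r))
        (Sum.elim (jfile r B st) (file [] st.2.2 zz [] [] [] [] []))
        (Sum.elim (jfile r (Function.update B (r .F2) []) (isortAbs^[ws.length] st))
          (file [] (isortAbs^[ws.length] st).2.2 zz [] [] [] [] []))
        (ws.length * (isortStepCost S + 2) + 1)
  | [], B, st, _, _, _, _, _, _, _, _, _, hF2, _, _ => by
    have hne : ∀ {i j : LIx}, i ≠ j → r i ≠ r j := fun h => r.injective.ne h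
    refine (Runs.loop_nil _ _ (by simp [jfile, hne, hF2])).of_eq ?_ (by simp)
    rw [Function.update_eq_self_iff.2 hF2.symm]; rfl
  | w :: ws, B, st, hA, hT, hM, hP, hH, hF, hO, hI, hD, hF2, hs, hy => by
    have hne : ∀ {i j : LIx}, i ≠ j → r i ≠ r j := fun h => r.injective.ne h
    have hk : (Sum.elim (jfile r B st) (file [] st.2.2 zz [] [] [] [] []) : Regs (κ ⊕ AReg)) (Sum.inl (r .F2)) = w :: ws := by
      simp [jfile, hne, hF2]
    have hupd : Function.update (Sum.elim (jfile r B st) (file [] st.2.2 zz [] [] [] [] []) : Regs (κ ⊕ AReg))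
        (Sum.inl (r .F2)) ws = Sum.elim (jfile r (Function.update B (r .F2) ws) st) (file [] st.2.2 zz [] [] [] [] []) := by
      rw [Sum.update_elim_inl]
      congr 1
      funext k
      by_cases h1 : k = r .F2
      · subst h1; simp [jfile, hne]
      · simp [jfile, Function.update_apply, h1]
    have hbody := runs_isortStep r (Function.update B (r .F2) ws) zz st S (by simp [hne, hA]) (by simp [hne, hT])
      (by simp [hne, hM]) (by simp [hne, hP]) (by simp [hne, hH]) (by simp [hne, hF]) (by simp [hne, hO])
      (by simp [hne, hI]) (by simp [hne, hD]) hs hy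
    rw [← hupd] at hbody
    obtain ⟨hs', hy'⟩ := size_isortAbs_iterate S 1 st hs hy
    simp only [Function.iterate_one] at hs' hy'
    have hrest := runs_isortLoop zz S ws (Function.update B (r .F2) ws) (isortAbs st) (by simp [hne, hA])
      (by simp [hne, hT]) (by simp [hne, hM]) (by simp [hne, hP]) (by simp [hne, hH]) (by simp [hne, hF])
      (by simp [hne, hO]) (by simp [hne, hI]) (by simp [hne, hD]) (by simp) hs' hy'
    rw [Function.update_idem] at hrest
    rw [List.length_cons, Function.iterate_succ_apply]
    cases w
    · exact (Runs.loop_false hk hbody hrest).of_eq rfl (by ring_nf; omega)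
    · exact (Runs.loop_true hk hbody hrest).of_eq rfl (by ring_nf; omega)

/-- **Simulation of `isort`**: from a base with `src = encList l`, `lst = encList acc`, the
work registers empty and the bank holding `x = 0`, `y = yc`, the sort consumes `src` and leaves
`lst = encList (isortModel acc l)` (the elements of `l` inserted in order into `acc`), within
`(|encList l| + 1) · (isortStepCost S + 2) + 10 |encList l| + 5` steps for any
`S ≥ |encList l| + |encList acc|`, `S ≥ |yc|`. [cite: CLRS2009, §2.1 (INSERTION-SORT)] -/
theorem runs_isort (B : Regs κ) (zz yc : List Bool) (l acc : List (List Bool)) (S : ℕ)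
    (hA : B (r .A) = []) (hT : B (r .T) = []) (hM : B (r .M) = []) (hP : B (r .P) = []) (hH : B (r .H) = [])
    (hF : B (r .F) = []) (hO : B (r .outR) = []) (hI : B (r .INS) = []) (hD : B (r .DN) = [])
    (hF2 : B (r .F2) = []) (hS : B (r .src) = encList l) (hL : B (r .lst) = encList acc)
    (hsz : (encList l).length + (encList acc).length ≤ S) (hy : yc.length ≤ S) :
    ∃ y' : List Bool, Runs (isort r) (Sum.elim B (file [] yc zz [] [] [] [] []))
      (Sum.elim (Function.update (Function.update B (r .src) []) (r .lst) (encList (isortModel acc l)))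
        (file [] y' zz [] [] [] [] []))
      (((encList l).length + 1) * (isortStepCost S + 2) + 10 * (encList l).length + 5) := by
  have hne : ∀ {i j : LIx}, i ≠ j → r i ≠ r j := fun h => r.injective.ne h
  set L := encList l with hLdef
  have h1 : Runs (copy (Sum.inl (r .src)) (Sum.inl (r .F2)) (Sum.inr AReg.s) (Sum.inr AReg.t) : Com (κ ⊕ AReg))
      (Sum.elim B (file [] yc zz [] [] [] [] [])) (Sum.elim (Function.update B (r .F2) L) (file [] yc zz [] [] [] [] []))
      (10 * L.length + 3) :=
    (runs_copy (by simp [hne]) (by simp) (by simp) (by simp) (by simp) (by simp) _ (by simp) (by simp)).of_eq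
      (by simp [-Sum.elim_update_left, -Sum.elim_update_right, hS, hF2, hLdef]) (by simp [hS, hLdef])
  set B' := Function.update B (r .F2) (true :: L) with hB'
  have h2 : Runs (push (Sum.inl (r .F2)) true : Com (κ ⊕ AReg)) (Sum.elim (Function.update B (r .F2) L) (file [] yc zz [] [] [] [] []))
      (Sum.elim B' (file [] yc zz [] [] [] [] [])) 1 :=
    Runs.push' (by simp [-Sum.elim_update_left, -Sum.elim_update_right, hB'])
  have hst : B' = jfile r B' (l, acc, yc) :=
    eq_jfile r _ _ _ (by simp [hB', hne, hS, hLdef]) (by simp [hB', hne, hL]) (fun _ _ _ => rfl)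
  have h3 := runs_isortLoop r zz S (true :: L) B' (l, acc, yc) (by simp [hB', hne, hA]) (by simp [hB', hne, hT])
    (by simp [hB', hne, hM]) (by simp [hB', hne, hP]) (by simp [hB', hne, hH]) (by simp [hB', hne, hF])
    (by simp [hB', hne, hO]) (by simp [hB', hne, hI]) (by simp [hB', hne, hD]) (by simp [hB'])
    (by simp only [jsize]; omega) hy
  rw [← hst] at h3
  obtain ⟨hrem, hacc⟩ := isortAbs_iterate l acc yc (true :: L).length
    (by simp only [List.length_cons, hLdef]; exact (length_le_length_encList l).trans (Nat.le_succ _))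
  have hB'' : Function.update B' (r .F2) ([] : List Bool) = B := by
    rw [hB', Function.update_idem]; exact Function.update_eq_self_iff.2 hF2.symm
  rw [hB''] at h3
  refine ⟨(isortAbs^[(true :: L).length] (l, acc, yc)).2.2, (h1.seq (h2.seq h3)).of_eq ?_ ?_⟩
  · congr 1
    simp only [jfile, hrem, hacc, encList_nil]
  · simp only [List.length_cons]; ring_nf; omega

/-- The sort returns a permutation of accumulator and input. [folklore] -/
theorem perm_isortModel : ∀ (l acc : List (List Bool)), (isortModel acc l).Perm (acc ++ l)
  | [], acc => by simp [isortModel]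
  | e :: l, acc => by
    have h1 := perm_isortModel l (insModel e acc)
    simp only [isortModel, List.foldl_cons] at h1 ⊢
    refine h1.trans ?_
    have h2 : (insModel e acc).Perm (e :: acc) := List.perm_orderedInsert _ _ _
    exact (h2.append_right l).trans List.perm_middle.symm

end SortLoop

end Com

end Literature.Computability.Complexity
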